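import Literature.AlgebraicGeometry.AbelianSchemes.AbelianSchemeKOfLEtaleOfConstantRank
import Literature.Algebra.Module.RingIsoBaseChange
import HarnessLib

/-!
# The fibre rank of a finite closed subgroup subscheme equals the number of its geometric points; `K(L)` is étale over an
# integral characteristic-zero base as soon as `|K(L_s̄)|` is constant (Mumford, *Abelian Varieties* §13; GW II 27.86 / 27.187)

Layer `Literature/AlgebraicGeometry/AbelianSchemes`, namespace `Literature.AlgebraicGeometry.AbelianSchemes.AbelianSchemeOver`.
Cell `hodgecm-mathlib` (D-0151), F-DAG leaf F-2c — file U5 of B-p08 (g12) (sequencer B-plan1 (g16) 07:13:38Z: the closer must read the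
remaining input (B2) in the GEOMETRIC-COUNT currency `Nat.card (A.kOfL L hL hε (Over.mk s))` of ★ `AbelianSchemeKOfLFibres`).
THEOREMS ONLY (no definition, no instance, no named fact, no `sorry`).

For `Z → Spec R` finite and a prime `𝔭` with residue field `K = κ(𝔭)`, the fibre `Z_𝔭 = Z ×_R Spec K` is affine with
`Γ(Z_𝔭, 𝒪) ≅ K ⊗_R Γ(Z, 𝒪)` (a pull-back square of affine schemes is a push-out square of rings: Mathlib
`isPushout_appTop_of_isPullback`, `CommRingCat.isPushout_iff_isPushout`, `Algebra.IsPushout.equiv`; the identifications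
`R ≅ Γ(Spec R)`, `K ≅ Γ(Spec K)` are moved through ★ `RingIsoBaseChange.tau` and a change-of-coefficients of bases), so
* `finrank_residueField_tensor_eq_finrank_Γ_pullback` — `dim_K (K ⊗_R Γ(Z, 𝒪)) = dim_K Γ(Z_𝔭, 𝒪)`;
when the fibre is ÉTALE (★ U3 `etale_pullback_obj_hom` for closed subgroup subschemes of abelian schemes over `ℚ`-algebras) the
latter is the number of `Ω`-points for `Ω ⊇ K` separably closed (★ `Motives.natCard_specHom_eq_finrank`), and the `Ω`-points of
`Z_𝔭` over `K` are the `Ω`-points of `Z` over `R` (universal property of the fibre product), which for `Z = K(L)` are the elements of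
★ `kOfL` at the geometric point (★ E13 `hZ` + `ι` mono):
* `finrank_residueField_tensor_eq_natCard_over` — `dim_K (K ⊗_R Γ(Z, 𝒪)) = Nat.card (Over.mk s̄ ⟶ Z)` for the étale fibre;
* **`exists_kOfL_etale_of_natCard_kOfL_eq`** — for every abelian scheme `A` over a Noetherian DOMAIN `R ⊇ ℚ` and every rigidified
  fibrewise-ample rank-one `L`: IF `Nat.card (A.kOfL L hL hε (Over.mk s)) = c` for every geometric point `s : Spec Ω → Spec R`
  (`Ω` algebraically closed), THEN `K(L)` is a closed subscheme of `A` finite ÉTALE over `Spec R` (★ U4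
  `exists_kOfL_etale_of_finrank_fibre_eq`).  The hypothesis is [MumfordAV1970] §16/§23 «`|K(L)| = χ(L)²`» + local constancy of
  `χ` — the one input of F-2c over an integral base not in the tree (B-p05 (g17) census).
HC_CM is proved only modulo the 7 printed citations until rung 0 closes; this file asserts nothing about HC.

## References
* [MumfordAV1970] D. Mumford, *Abelian Varieties* (1970), §5 Cor. 2 (p. 50), §13 (p. 123).
* [GortzWedhorn2023] U. Görtz, T. Wedhorn, *Algebraic Geometry II* (2023), Prop. 27.86 (p. 633), Prop. 27.187, Cor. 27.63, (27.1.1).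
* [GortzWedhorn2020] U. Görtz, T. Wedhorn, *Algebraic Geometry I*, 2nd ed. (2020), Prop. 4.16 (p. 101), Section (4.8).
* [Hartshorne1977] R. Hartshorne, *Algebraic Geometry* (1977), II Ex. 5.8 (c).
-/

set_option autoImplicit false

noncomputable section

-- `TopCat.Presheaf`/`Scheme.Modules` are not reducible (as in ★ `AbelianSchemeKOfL`).
set_option backward.isDefEq.respectTransparency false

open CategoryTheory CategoryTheory.Limits AlgebraicGeometry MonoidalCategory CartesianMonoidalCategory TensorProduct

open scoped MonObj

namespace Literature.AlgebraicGeometry.AbelianSchemes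

open Literature.AlgebraicGeometry.Motives Literature.AlgebraicGeometry.AbelianVarieties
  Literature.AlgebraicGeometry.Modules Literature.Algebra.Module

namespace AbelianSchemeOver

/-! ## §0 Dimension under compatible scalar structures along a field isomorphism -/

/-- `dim_K M = dim_{K₀} M` for compatible structures `k • m = e k • m` along a ring isomorphism `e : K ≅ K₀` of division rings
(change of coefficients of a basis, Mathlib `Basis.mapCoeffs`). [folklore] [cite: Hartshorne1977, II Ex. 5.8 (c)] -/
theorem finrank_eq_of_ringEquiv_compat {K K₀ M : Type*} [DivisionRing K] [CommRing K₀] [Nontrivial K₀] [AddCommGroup M]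
    [Module K M] [Module K₀ M] (e : K ≃+* K₀) (h : ∀ (k : K) (m : M), k • m = e k • m) :
    Module.finrank K M = Module.finrank K₀ M := by
  let b := Module.Free.chooseBasis K M
  let b₀ : Module.Basis (Module.Free.ChooseBasisIndex K M) K₀ M := b.mapCoeffs e fun c x => (h c x).symm
  exact congrArg Cardinal.toNat (b.mk_eq_rank''.symm.trans b₀.mk_eq_rank'')

/-! ## §1 The fibre rank as the rank of the fibre -/

section FibreRank

variable {R : Type} [CommRing R] {Z : Over (Spec (.of R))} [IsFinite Z.hom] (K : Type) [Field K] [Algebra R K]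

/-- **`dim_K (K ⊗_R Γ(Z, 𝒪)) = dim_K Γ(Z_K, 𝒪)`** for a field `K` over `R` (e.g. `κ(𝔭)`), `Z_K = Z ×_R Spec K`, `Z → Spec R` finite: the
pull-back square of affine schemes is a push-out square of global sections (Mathlib `isPushout_appTop_of_isPullback` +
`Algebra.IsPushout.equiv`), read through `R ≅ Γ(Spec R)`, `K ≅ Γ(Spec K)` (★ `RingIsoBaseChange.tau`, `finrank_eq_of_ringEquiv_compat`).
[cite: GortzWedhorn2020, Prop. 4.16 (p. 101) and Section (4.8)] -/
theorem finrank_tensor_eq_finrank_Γ_pullback :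
    letI := (Motives.algebraMapΓ Z.hom).hom.toAlgebra
    letI := (Motives.algebraMapΓ (pullback.snd Z.hom (Spec.map (CommRingCat.ofHom (algebraMap R K))))).hom.toAlgebra
    Module.finrank K (K ⊗[R] Γ(Z.left, ⊤)) =
      Module.finrank K Γ(pullback Z.hom (Spec.map (CommRingCat.ofHom (algebraMap R K))), ⊤) := by
  haveI : IsAffine Z.left := isAffine_of_isAffineHom Z.hom
  -- the push-out square of global sections: `IsPushout Z.hom.appTop t.appTop fst.appTop snd.appTop`
  have hpo := isPushout_appTop_of_isPullback
    (IsPullback.of_hasPullback Z.hom (Spec.map (CommRingCat.ofHom (algebraMap R K))))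
  algebraize [Z.hom.appTop.hom, (Spec.map (CommRingCat.ofHom (algebraMap R K))).appTop.hom,
    (pullback.fst Z.hom (Spec.map (CommRingCat.ofHom (algebraMap R K)))).appTop.hom,
    (pullback.snd Z.hom (Spec.map (CommRingCat.ofHom (algebraMap R K)))).appTop.hom,
    (pullback.fst Z.hom (Spec.map (CommRingCat.ofHom (algebraMap R K)))).appTop.hom.comp Z.hom.appTop.hom]
  have : IsScalarTower Γ(Spec (.of R), ⊤) Γ(Spec (.of K), ⊤)
      Γ(pullback Z.hom (Spec.map (CommRingCat.ofHom (algebraMap R K))), ⊤) :=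
    .of_algebraMap_eq' congr($(hpo.1.1).hom)
  have hP : Algebra.IsPushout Γ(Spec (.of R), ⊤) Γ(Z.left, ⊤) Γ(Spec (.of K), ⊤)
      Γ(pullback Z.hom (Spec.map (CommRingCat.ofHom (algebraMap R K))), ⊤) :=
    CommRingCat.isPushout_iff_isPushout.mp hpo
  haveI := hP.symm
  -- `Γ(Spec K) ⊗[Γ(Spec R)] Γ(Z) ≃ₗ[Γ(Spec K)] Γ(Z_K)`
  let e₀ := (Algebra.IsPushout.equiv Γ(Spec (.of R), ⊤) Γ(Spec (.of K), ⊤) Γ(Z.left, ⊤)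
    Γ(pullback Z.hom (Spec.map (CommRingCat.ofHom (algebraMap R K))), ⊤)).toLinearEquiv
  -- the ring identifications `R ≅ Γ(Spec R)`, `K ≅ Γ(Spec K)`
  let eR : R ≃+* Γ(Spec (.of R), ⊤) := (Scheme.ΓSpecIso (.of R)).symm.commRingCatIsoToRingEquiv
  let eK : K ≃+* Γ(Spec (.of K), ⊤) := (Scheme.ΓSpecIso (.of K)).symm.commRingCatIsoToRingEquiv
  letI : Algebra R Γ(Z.left, ⊤) := (Motives.algebraMapΓ Z.hom).hom.toAlgebra
  letI algK : Algebra K Γ(pullback Z.hom (Spec.map (CommRingCat.ofHom (algebraMap R K))), ⊤) :=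
    (Motives.algebraMapΓ (pullback.snd Z.hom (Spec.map (CommRingCat.ofHom (algebraMap R K))))).hom.toAlgebra
  -- compatibility of the two structures on `Γ(Z)` and on `Γ(Z_K)`
  have hZcompat : ∀ (r : R) (m : Γ(Z.left, ⊤)), r • m = eR r • m := fun r m => rfl
  have hGcompat : ∀ (k : K) (m : Γ(pullback Z.hom (Spec.map (CommRingCat.ofHom (algebraMap R K))), ⊤)),
      k • m = eK k • m := fun k m => rfl
  have heK : ∀ r : R, eK (algebraMap R K r) = algebraMap Γ(Spec (.of R), ⊤) Γ(Spec (.of K), ⊤) (eR r) := by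
    intro r
    change ((Scheme.ΓSpecIso (.of K)).inv) ((CommRingCat.ofHom (algebraMap R K)) r) =
      (Spec.map (CommRingCat.ofHom (algebraMap R K))).appTop ((Scheme.ΓSpecIso (.of R)).inv r)
    rw [← CommRingCat.comp_apply, ← CommRingCat.comp_apply, Scheme.ΓSpecIso_inv_naturality]
  -- `τ : K ⊗[R] Γ(Z) ≃+ Γ(Spec K) ⊗[Γ(Spec R)] Γ(Z)`, `eK`-semilinear; read the target as a `K`-module through `eK`
  letI modK : Module K (Γ(Spec (.of K), ⊤) ⊗[Γ(Spec (.of R), ⊤)] Γ(Z.left, ⊤)) := Module.compHom _ eK.toRingHom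
  let τK : K ⊗[R] Γ(Z.left, ⊤) ≃ₗ[K] Γ(Spec (.of K), ⊤) ⊗[Γ(Spec (.of R), ⊤)] Γ(Z.left, ⊤) :=
    { RingIsoBaseChange.tau eR eK heK hZcompat with
      map_smul' := fun k z => RingIsoBaseChange.tau_smul eR eK heK hZcompat k z }
  haveI : Nontrivial Γ(Spec (.of K), ⊤) := eK.symm.toRingHom.domain_nontrivial
  have hTcompat : ∀ (k : K) (z : Γ(Spec (.of K), ⊤) ⊗[Γ(Spec (.of R), ⊤)] Γ(Z.left, ⊤)), k • z = eK k • z :=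
    fun k z => rfl
  rw [τK.finrank_eq, finrank_eq_of_ringEquiv_compat eK hTcompat, e₀.finrank_eq]
  exact (finrank_eq_of_ringEquiv_compat eK hGcompat).symm

end FibreRank

/-! ## §2 Geometric points of the fibre = points of `Z` over the geometric point -/

section Points

variable {R : Type} [CommRing R] {Z : Over (Spec (.of R))}
  (K : Type) [Field K] [Algebra R K] (Ω : Type) [Field Ω] [Algebra R Ω] [Algebra K Ω] [IsScalarTower R K Ω]

/-- **`Ω`-points of the fibre `Z_K` over `K` = `Ω`-points of `Z` over `R`** through `R → K → Ω` (universal property of the fibre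
product). [cite: GortzWedhorn2020, Prop. 4.16 (p. 101) and Section (4.8)] -/
def specHomPullbackEquivOver :
    {x : Spec (.of Ω) ⟶ pullback Z.hom (Spec.map (CommRingCat.ofHom (algebraMap R K))) //
        x ≫ pullback.snd Z.hom (Spec.map (CommRingCat.ofHom (algebraMap R K))) =
          Spec.map (CommRingCat.ofHom (algebraMap K Ω))} ≃
      ((Over.mk (Spec.map (CommRingCat.ofHom (algebraMap R Ω))) : Over (Spec (.of R))) ⟶ Z) where
  toFun x := Over.homMk (x.1 ≫ pullback.fst Z.hom _) (by
    change (x.1 ≫ pullback.fst Z.hom _) ≫ Z.hom = Spec.map (CommRingCat.ofHom (algebraMap R Ω))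
    rw [Category.assoc, pullback.condition, ← Category.assoc, x.2, ← Spec.map_comp, ← CommRingCat.ofHom_comp,
      ← IsScalarTower.algebraMap_eq R K Ω])
  invFun v := ⟨pullback.lift v.left (Spec.map (CommRingCat.ofHom (algebraMap K Ω))) (by
      rw [Over.w v]
      change Spec.map (CommRingCat.ofHom (algebraMap R Ω)) = _
      rw [← Spec.map_comp, ← CommRingCat.ofHom_comp, ← IsScalarTower.algebraMap_eq R K Ω]),
    pullback.lift_snd _ _ _⟩
  left_inv x := Subtype.ext (pullback.hom_ext (by simp) (by simpa using x.2.symm))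
  right_inv v := Over.OverMorphism.ext (by simp)

end Points

/-! ## §3 `K(L)`: étale over an integral base from the constancy of `|K(L_s̄)|` -/

section KOfL

variable {R : Type} [CommRing R] (A : AbelianSchemeOver (Spec (.of R)))

/-- `K(L)(Spec Ω)` (★ `kOfL`) ≃ morphisms `Spec Ω → Z` over `R`, for a closed subscheme `i : Z ↪ A` representing `K(L)`
(`hZ` of ★ `exists_isClosedImmersion_iff_memKOfL*`; `i` is a monomorphism). [cite: MumfordAV1970, §13 (p. 123)] -/
def overHomEquivKOfL {Z : Over (Spec (.of R))} (i : Z ⟶ A.X) [IsClosedImmersion i.left] {L : A.left.Modules} (hL : HasRank L 1)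
    (hε : CechPic.pullback A.unitSection (detClass (HasRank.isFiniteLocallyFree' hL)) = 1)
    (hZ : ∀ (T : Over (Spec (.of R))) (u : T ⟶ A.X), (∃ v : T ⟶ Z, v ≫ i = u) ↔ A.MemKOfL L u)
    (T : Over (Spec (.of R))) : (T ⟶ Z) ≃ A.kOfL L hL hε T where
  toFun v := ⟨v ≫ i, (A.mem_kOfL_iff hL hε _).2 ((hZ T _).1 ⟨v, rfl⟩)⟩
  invFun u := Classical.choose ((hZ T u.1).2 ((A.mem_kOfL_iff hL hε _).1 u.2))
  left_inv v := by
    haveI : Mono i := Over.mono_of_mono_left i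
    have h := Classical.choose_spec ((hZ T (v ≫ i)).2 ((A.mem_kOfL_iff hL hε _).1
      ((A.mem_kOfL_iff hL hε _).2 ((hZ T _).1 ⟨v, rfl⟩))))
    exact (cancel_mono i).1 h
  right_inv u := Subtype.ext (Classical.choose_spec ((hZ T u.1).2 ((A.mem_kOfL_iff hL hε _).1 u.2)))

/-- **`K(L)` IS FINITE ÉTALE OVER AN INTEGRAL BASE OF CHARACTERISTIC ZERO AS SOON AS `|K(L_s̄)|` IS CONSTANT**: for every abelian scheme
`A` over a Noetherian domain `R ⊇ ℚ`, every rank-one `L` rigidified along the identity section and fibrewise of the class of an ample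
divisor, and every `c`, IF `Nat.card (K(L)(Spec Ω)) = c` at every geometric point `s : Spec Ω → Spec R` (★ `kOfL`; `Ω` algebraically
closed), THEN the closed subscheme `Z ↪ A` representing `K(L)` is finite ÉTALE over `Spec R`.  (At a prime `𝔭`: the fibre rank
`dim_{κ(𝔭)} (κ(𝔭) ⊗_R Γ(Z, 𝒪))` is `dim_{κ(𝔭)} Γ(Z_𝔭, 𝒪)` (§1), the fibre `Z_𝔭` is étale (★ U3 `etale_pullback_obj_hom`), so that
dimension is the number of `κ(𝔭)‾`-points (★ `natCard_specHom_eq_finrank`) = `Nat.card (K(L)(Spec κ(𝔭)‾)) = c` (§2); then ★ U4.)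
The hypothesis is «`|K(L)| = χ(L)²`» [MumfordAV1970] §16/§23 with the local constancy of `χ` — not in the tree.
[cite: MumfordAV1970, §13 (p. 123)] [cite: MumfordAV1970, §5 Cor. 2 (p. 50)] [cite: GortzWedhorn2023, Prop. 27.187 and Cor. 27.63] -/
theorem exists_kOfL_etale_of_natCard_kOfL_eq [IsDomain R] [IsNoetherianRing R] [Algebra ℚ R] {L : A.left.Modules}
    (hL : HasRank L 1) (hε : CechPic.pullback A.unitSection (detClass (HasRank.isFiniteLocallyFree' hL)) = 1)
    (hΘ : ∀ ⦃Ω : Type⦄ [Field Ω] [IsAlgClosed Ω] (s : Spec (.of Ω) ⟶ Spec (.of R)),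
      ∃ Θ : CartierDivisor (A.fibre s).toAbelianVariety.X.left, Θ.IsAmple ∧
        CechPic.pullback (X := (A.fibre s).toAbelianVariety.X.left) (pullback.fst A.X.hom s)
          (detClass (HasRank.isFiniteLocallyFree' hL)) = Θ.cechClass)
    (c : ℕ) (hcard : ∀ ⦃Ω : Type⦄ [Field Ω] [IsAlgClosed Ω] (s : Spec (.of Ω) ⟶ Spec (.of R)),
      Nat.card (A.kOfL L hL hε (Over.mk s)) = c) :
    ∃ (Z : Over (Spec (.of R))) (i : Z ⟶ A.X) (_ : IsClosedImmersion i.left) (_ : IsFinite Z.hom) (_ : Etale Z.hom),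
      ∀ (T : Over (Spec (.of R))) (u : T ⟶ A.X), (∃ v : T ⟶ Z, v ≫ i = u) ↔ A.MemKOfL L u := by
  obtain ⟨Z, i, hci, hfin, hZ⟩ := A.exists_isClosedImmersion_isFinite_iff_memKOfL_of_isNoetherianRing hL hε hΘ
  obtain ⟨he, hm, hn⟩ := A.exists_one_mul_inv_fac_of_memKOfL i hL hε hZ
  refine ⟨Z, i, hci, hfin, A.etale_hom_of_subgroup_of_finrank_fibre_eq i he hm hn c fun p => ?_, hZ⟩
  -- at the prime `𝔭`: `K = κ(𝔭)` (characteristic `0`), `Ω = κ(𝔭)‾`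
  let K := p.asIdeal.ResidueField
  haveI : CharZero K := charZero_of_injective_ringHom ((algebraMap R K).comp (algebraMap ℚ R)).injective
  let Ω := AlgebraicClosure K
  -- the fibre is affine and étale
  haveI : IsAffine (pullback Z.hom (Spec.map (CommRingCat.ofHom (algebraMap R K)))) :=
    isAffine_of_isAffineHom (pullback.snd Z.hom (Spec.map (CommRingCat.ofHom (algebraMap R K))))
  haveI : Etale (pullback.snd Z.hom (Spec.map (CommRingCat.ofHom (algebraMap R K)))) :=
    A.etale_pullback_obj_hom i he hm hn (Spec.map (CommRingCat.ofHom (algebraMap R K)))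
  -- §1: fibre rank = rank of the fibre; ★: rank of the étale fibre = number of `Ω`-points; §2: those are `K(L)(Spec Ω)`
  rw [finrank_tensor_eq_finrank_Γ_pullback K,
    ← natCard_specHom_eq_finrank (pullback.snd Z.hom (Spec.map (CommRingCat.ofHom (algebraMap R K)))) Ω,
    Nat.card_congr ((specHomPullbackEquivOver K Ω).trans (A.overHomEquivKOfL i hL hε hZ _))]
  exact hcard (Spec.map (CommRingCat.ofHom (algebraMap R Ω)))

end KOfL

end AbelianSchemeOver

end Literature.AlgebraicGeometry.AbelianSchemes

end
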